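import Literature.NumberTheory.EllipticCurves.ZpExtensionGaloisTwist
import Literature.NumberTheory.GaloisRepresentations.LocalGlobalCohomology
import HarnessLib

/-!
# The Tate dual of a unit twist is the inverse twist of the Tate dual: `M(χ_u)^D = M^D(χ_u⁻¹)`
# (Greenberg, LNM 1716, p. 124: «`M^* = A_{−s}`»)

Greenberg, *Iwasawa theory for elliptic curves*, LNM 1716 (1999), §4 p. 124 (proof of Prop. 4.14):
«We let `M = A_s` … Note that `M^* = A_{−s}`.»  Here `A_s = E[p^∞] ⊗ κ^s` and `M^* = Hom(M, μ_{p^∞})`.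
At a finite level `J` and for an integer twist parameter `u ≡ 1 (mod p)` (the tree's
`ZpExtension.galoisTwist κ ρ J hM u hu`, `σ ↦ u^{e_J(σ)} ρ(σ)`, file `ZpExtensionGaloisTwist.lean`) and the
tree's Tate dual `DiscreteGaloisModule.tateDual ρ n = Hom(M, μₙ)` with `(σf)(m) = σ f(σ⁻¹ m)`
(`GaloisRepresentations/LocalGlobalCohomology.lean`), the statement is an EQUALITY of discrete Galois
modules on the carrier `Hom(M, μₙ)`:

  `(κ.galoisTwist ρ J hM u hu).tateDual n = κ.galoisTwist (ρ.tateDual n) J _ u' hu'`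

for any integer `u'` with `u u' ≡ 1 (mod p^J)` (`tateDual_galoisTwist`): indeed
`(σ f)(m) = σ f(u^{e(σ⁻¹)} ρ(σ⁻¹) m) = u^{e(σ⁻¹)} · σ f(ρ(σ⁻¹) m)` and `u^{e(σ⁻¹)} ≡ u'^{e(σ)} (mod p^J)`
because `e(σ⁻¹) + e(σ) ≡ 0` (`twistExponent_mul`) and `u u' ≡ 1`.  This is the identification
`E[p^J](χ_u)^D ≅ E[p^J](χ_u⁻¹)` (after the Weil pairing `E[n]^D ≅ E[n]`, tree `WeilPairingTateDual`)
used on the dual side of the twisted Poitou–Tate lifting (cell `bsd-2adic`, ADDENDUM-16 (δ)/(β)).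
THEOREMS ONLY (no definition, no named fact).

* `pow_nsmul_tateDual_eq_zero` — `p^J` kills `Hom(M, μₙ)` when it kills `M`;
* `prime_pow_dvd_pow_sub_pow` — the integer congruence `p^J ∣ u^a − u'^b` for `p^J ∣ a + b`, `p^J ∣ uu' − 1`;
* `tateDual_galoisTwist` — the equality of Galois modules.

References: [GreenbergLNM1716] §4 p. 124; [MilneADT2006] Ch. I §0, §2 (the dual `M^D = Hom(M, μ)` and its
Galois action); [Washington1997] §13.1.
-/

noncomputable section

open scoped Classical

universe u

namespace Literature.NumberTheory.EllipticCurves.ZpExtension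

open Field Literature.NumberTheory.GaloisRepresentations
  Literature.NumberTheory.GaloisRepresentations.DiscreteGaloisModule

variable {K : Type u} [Field K] {p : ℕ} [hp : Fact p.Prime] (κ : ZpExtension K p)
  {M : Type u} [AddCommGroup M] [TopologicalSpace M] [DiscreteTopology M]

omit hp [TopologicalSpace M] [DiscreteTopology M] in
/-- `p^J` kills `Hom(M, μₙ)` when it kills `M` (`(p^J f)(m) = f(p^J m)`). [cite: MilneADT2006, Ch. I §2] -/
theorem pow_nsmul_tateDual_eq_zero {J : ℕ} (hM : ∀ m : M, p ^ J • m = 0) (n : ℕ) (f : TateDual K M n) :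
    p ^ J • f = 0 :=
  TateDual.ext fun m ↦ by
    change p ^ J • f m = 0
    rw [← map_nsmul, hM, map_zero]

omit hp in
/-- The integer congruence behind `χ_u(σ⁻¹) = χ_{u'}(σ)`: if `p ∣ u − 1`, `p^J ∣ u u' − 1` and
`p^J ∣ a + b` then `p^J ∣ u^a − u'^b` — write `u^a − u'^b = u^a (1 − (uu')^b) + u'^b (u^{a+b} − 1)` and use
`p^{J} ∣ u^{p^J k} − 1`. [cite: Washington1997, §13.1] -/
theorem prime_pow_dvd_pow_sub_pow {J : ℕ} {u u' : ℤ} (hu : (p : ℤ) ∣ u - 1)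
    (huu' : ((p : ℤ) ^ J) ∣ u * u' - 1) {a b : ℕ} (hab : p ^ J ∣ a + b) :
    ((p : ℤ) ^ J) ∣ u ^ a - u' ^ b := by
  obtain ⟨k, hk⟩ := hab
  have h1 : ((p : ℤ) ^ J) ∣ 1 - (u * u') ^ b := by
    have h := sub_dvd_pow_sub_pow (1 : ℤ) (u * u') b
    rw [one_pow] at h
    have h' : ((p : ℤ) ^ J) ∣ 1 - u * u' := by
      have := huu'.neg_right; rwa [neg_sub] at this
    exact h'.trans h
  have h2 : ((p : ℤ) ^ J) ∣ u ^ (a + b) - 1 := by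
    have hJ : ((p : ℤ) ^ J) ∣ u ^ p ^ J - 1 := by
      have h := dvd_sub_pow_of_dvd_sub (R := ℤ) (p := p) (a := u) (b := 1) hu J
      rw [one_pow] at h
      exact (pow_dvd_pow (p : ℤ) (Nat.le_succ J)).trans h
    rw [hk, pow_mul]
    have h := sub_dvd_pow_sub_pow (u ^ p ^ J) 1 k
    rw [one_pow] at h
    exact hJ.trans h
  have key : u ^ a - u' ^ b = u ^ a * (1 - (u * u') ^ b) + u' ^ b * (u ^ (a + b) - 1) := by ring
  rw [key]
  exact dvd_add (h1.mul_left _) (h2.mul_left _)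

/-- **`M(χ_u)^D = M^D(χ_{u'})` for `u u' ≡ 1 (mod p^J)`** (Greenberg: «`M^* = A_{−s}`» for `M = A_s`): the
Tate dual of the unit twist `κ.galoisTwist ρ J hM u hu` IS the unit twist with the inverse parameter `u'`
of the Tate dual `ρ.tateDual n`, as discrete `Γ_K`-modules on `Hom(M, μₙ)`:
`(σ f)(m) = σ f(u^{e(σ⁻¹)} ρ(σ⁻¹) m) = u^{e(σ⁻¹)} σ f(ρ(σ⁻¹) m) = u'^{e(σ)} (σ ·_{ρ^D} f)(m)`, the last
step by `prime_pow_dvd_pow_sub_pow` (`e(σ⁻¹) + e(σ) ≡ e(1) = 0 (mod p^J)`, `twistExponent_mul`) since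
`p^J` kills `σ f(ρ(σ⁻¹) m)`. [cite: GreenbergLNM1716, §4 p. 124] [cite: MilneADT2006, Ch. I §2] -/
theorem tateDual_galoisTwist [Finite M] (ρ : DiscreteGaloisModule K M) (J : ℕ)
    (hM : ∀ m : M, p ^ J • m = 0) {u u' : ℤ} (hu : (p : ℤ) ∣ u - 1) (hu' : (p : ℤ) ∣ u' - 1)
    (huu' : ((p : ℤ) ^ J) ∣ u * u' - 1) (n : ℕ) :
    (κ.galoisTwist ρ J hM u hu).tateDual n =
      κ.galoisTwist (ρ.tateDual n) J (pow_nsmul_tateDual_eq_zero hM n) u' hu' := by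
  refine ContinuousRep.ext fun σ ↦ LinearMap.ext fun f ↦ TateDual.ext fun m ↦ ?_
  rw [tateDual_apply_apply_apply, galoisTwist_apply_apply, galoisTwist_apply_apply, map_zsmul]
  -- both sides in `μₙ` (`MuCarrier K n`)
  refine (map_zsmul (mu K n σ) (u ^ κ.twistExponent J σ⁻¹) (f (ρ σ⁻¹ m))).trans ?_
  change (u ^ κ.twistExponent J σ⁻¹) • mu K n σ (f (ρ σ⁻¹ m)) =
    (u' ^ κ.twistExponent J σ) • mu K n σ (f (ρ σ⁻¹ m))
  -- `p^J` kills `X := σ f(ρ(σ⁻¹) m)`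
  have h0 : p ^ J • f (ρ σ⁻¹ m) = 0 := by rw [← map_nsmul, hM, map_zero]
  have hX : ((p : ℤ) ^ J) • mu K n σ (f (ρ σ⁻¹ m)) = 0 := by
    rw [← Nat.cast_pow, natCast_zsmul, ← map_nsmul]
    exact (congrArg (mu K n σ) h0).trans (map_zero _)
  -- `p^J ∣ e(σ⁻¹) + e(σ)`
  have hab : p ^ J ∣ κ.twistExponent J σ⁻¹ + κ.twistExponent J σ := by
    apply Nat.dvd_of_mod_eq_zero
    rw [← κ.twistExponent_mul J σ⁻¹ σ, inv_mul_cancel, twistExponent_one]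
  obtain ⟨c, hc⟩ := prime_pow_dvd_pow_sub_pow hu huu' hab
  rw [← sub_eq_zero, ← sub_smul, hc, mul_comm, mul_smul, hX, smul_zero]

end Literature.NumberTheory.EllipticCurves.ZpExtension

end
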